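import Summits.QuantumFields.YangMills.Theorems.UnitScaleTiltFluctuationComparisonRegPrGlobalSlack
import HarnessLib

/-!
# `UnitScaleTiltFluctuationComparisonRegPrGlobalSlackBeta` — KING'S SLACK ROW WITH THE PRINTED POLYNOMIAL LOSS `L^{βn}` IN THE RATE HALF, AND ITS DIRECT CONSUMER
# (crux `FluctuationComparisonRegPrL`, stmt-QuantumFields-19935, STUB 3⁗ rate half; OWNER RULING ym3-torus-plan g20-№11 ADDENDUM 2, 2026-08-27T11:06Z)

Seat ym3-torus-p2 g14 (the lineage that ported p523985 `…GlobalSlack`).  THE β-WEAKENING OF THE GLOBAL TWO-RUN ROW, pre-authorised in the v5j‴ docstring of STUB 3⁗ and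
triggered by ym3-torus-lit g13's located reading of print (LIT-INDEX §4 L-23): [King1986] Thm 3.4 is proved with the rate term `C·L^{−γk}·(L^kε)^{−β}·|T|`, `β = d + ½`
((3.42) p.660), the per-site loss `(L^kε)^{−1/2}` being LOCATED at the comparison of the two runs' background phase factors ((3.72) p.665); the kernel rates proper
(Prop. 3.8 (3.71), Prop. 3.9 (3.73)–(3.75)) are loss-free.  In the T³ dictionary of the landed port (`k = K − n` steps, current spacing `L^kε = L^{−n}`) print's loss
`(L^kε)^{−β}` is `L^{βn}` and print's rate `L^{−γk}` is `L^{−a(K−n)}`.  So the row a finite-order two-run comparison delivers AS PRINTED is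

  `|PintH (K+1) n V − PintH K n V − c K n| ≤ C·|𝕋_n|·(L^{βn}·L^{−a(K−n)} + θ(n)^σ)`   (`GlobalSupRateTSlackB D b₀ p₀ a β σ C`, §1),

i.e. the landed `GlobalSlack.GlobalSupRateTSlack` (p523985 l.64) with the window normalisation `θ(n)²` of the rate summand REPLACED by the polynomial loss `L^{βn}`
(slack summand `θ(n)^σ` unchanged).  CONTENT OF THIS FILE (bookkeeping only; nothing is asserted about the Bałaban data — the `def` is a hypothesis schema):
(1) §1 the schema and `slackB_of_slack` (`0 ≤ β`, `θ ≤ 1` on the heights ⇒ the landed row implies the β-row with the SAME constant — nothing proved for 3⁗-as-registered is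
lost) plus `slackB_of_slack_const` (no `θ ≤ 1` hypothesis, constant enlarged by `max 1 Θ²`, `Θ = b₀(2p₀)^{p₀}e^{½−p₀}γ^{1/4}` the uniform threshold bound);
(2) §2 the free-fraction arithmetic with the extra factor: along `n = ⌊K/m⌋`, `(3+β)n − a(K−n) ≤ −(a − (3+β+a)/m)·K`, geometric once `m > (3+β+a)/a`
([King1986] (3.12)–(3.13) p.657 «γ′(m−1) > β» — print's own reason for the free fraction `m`);
(3) §3 THE DIRECT CONSUMER `cauchyAtHeights_of_globalSupRateTSlackB` = the port's l.218 statement with `hm : (3 + β + a)/a < m` (proof = the port's, via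
`GlobalSlack.cauchyAtHeights_of_windowBound`, the factor `L^{β⌊K/m⌋}` folded into the geometric ratio `r₁ = L^{−(a − (3+β+a)/m)}`), its `σ ≥ 7` sharp-profile form, and
(4) §4 the registered-shape S-E″ slot `levelCauchyOfGlobalSupRateTSlackB_dec` = the port's l.354 with `m₀(a) ↦ m₀(a, β) = ⌈(3+β+a)/a⌉ + 1` — hence `β` must be bound
NEXT TO `a` (before `m₀`) in the re-cut 3⁗ text, exactly as the STUB 3⁗ docstring's pre-authorisation says («`∃ β ≥ 0` bound next to `∃ a`»).  CONSUMER-NEUTRAL downstream: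
`LogComparisonSocket.stubBody_of_rep_of_cauchy` reads only `CauchyAtHeights`.

References: C. King, CMP 102 (1986) 649–677 [King1986] (Thm 3.4 (3.9) p.656, (3.12)–(3.13) p.657, (3.42) p.660, (3.72)–(3.75) p.665);
T. Bałaban, CMP 102 (1985) 255–275 [Balaban1985UV3] ((7) p.257, (57) p.270).
-/

noncomputable section

open MeasureTheory Filter Topology
open Literature.MathematicalPhysics.QuantumFieldTheory.Balaban1983to89
open Literature.MathematicalPhysics.QuantumFieldTheory.Balaban1983to89.T3ContinuumYM3Torus
open Literature.MathematicalPhysics.QuantumFieldTheory.Balaban1983to89.T3LevelShift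
open Literature.MathematicalPhysics.QuantumFieldTheory.Balaban1983to89.T3UnitScaleTilt
open Literature.MathematicalPhysics.QuantumFieldTheory.Balaban1983to89.T3LogComparisonSocket
open Literature.MathematicalPhysics.QuantumFieldTheory.Balaban1983to89.T3AlphaInputsAC
open Literature.MathematicalPhysics.QuantumFieldTheory.Balaban1983to89.T3AlphaPolymerSocket
open Literature.MathematicalPhysics.QuantumFieldTheory.Balaban1983to89.T3AlphaInputsACTwoRunLevel
open Summit.QuantumFields.YangMills.Theorems.LogComparisonPolymerBudget
open Summit.QuantumFields.YangMills.Theorems.GlobalSlack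

namespace Summit.QuantumFields.YangMills.Theorems.GlobalSlackBeta

variable {F : T3Family} {γ : ℝ}

/-! ## §1 The β-row (King's (3.9) with the printed loss `(L^kε)^{−β} = L^{βn}` in the rate half) and its relation to the landed row -/

section Defs

variable (D : AlphaDataT3 F γ)

/-- **THE GLOBAL TWO-RUN BOUND WITH KING'S ADDITIVE SLACK AND THE PRINTED POLYNOMIAL LOSS** (hypothesis schema, never asserted; OWNER RULING g20-№11 ADDENDUM 2):
on the `θ(n)`-window, `|PintH (K+1) n V − PintH K n V − c K n| ≤ C·#Site(F.P n)·(L^{βn}·L^{−a(K−n)} + θ(n)^σ)` for all `n ≤ K` — [King1986] Thm 3.4 (3.9)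
`c(L^{−γk}(L^kε)^{−β} + (L^kε)^σ)|T|` in the T³ dictionary (`L^kε = L^{−n}`, `k = K − n`), the loss `β = d + ½` of (3.42) p.660 located at (3.72) p.665.
The landed `GlobalSlack.GlobalSupRateTSlack` is this text with `θ(n)²` in place of `L^{βn}`. [cite: King1986, Thm 3.4 (3.9) p.656 and (3.42) p.660] -/
def GlobalSupRateTSlackB (b₀ p₀ a β : ℝ) (σ : ℕ) (C : ℝ) : Prop :=
  ∃ c : ℕ → ℕ → ℝ, ∀ (K n : ℕ), n ≤ K → ∀ V : GaugeField (F.P n) 0 (Matrix.specialUnitaryGroup (Fin 2) ℂ), PlaqSmall (θBal F.L γ b₀ p₀ n) V →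
    |D.PintH (K + 1) n V - D.PintH K n V - c K n| ≤
      C * (Fintype.card (Site (F.P n) 0) : ℝ) * ((F.L : ℝ) ^ (β * n) * (((F.L : ℝ) ^ (K - n))⁻¹) ^ a + θBal F.L γ b₀ p₀ n ^ σ)

/-- **THE LANDED ROW IMPLIES THE β-ROW WITH THE SAME CONSTANT** when `0 ≤ β` and the thresholds are at most one on the heights (`θ(n)² ≤ 1 ≤ L^{βn}`, `L ≥ 1`):
nothing proved for 3⁗-as-registered is lost. [cite: King1986, Thm 3.4 (3.9) p.656] -/
theorem slackB_of_slack {b₀ p₀ a β C : ℝ} {σ : ℕ} (hL : 1 ≤ F.L) (hγ : 0 < γ) (hγ1 : γ ≤ 1) (hb : 0 < b₀) (hC : 0 ≤ C) (hβ : 0 ≤ β)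
    (hθ1 : ∀ n, θBal F.L γ b₀ p₀ n ≤ 1) (h : GlobalSupRateTSlack D b₀ p₀ a σ C) : GlobalSupRateTSlackB D b₀ p₀ a β σ C := by
  obtain ⟨c, hc⟩ := h
  refine ⟨c, fun K n hn V hV => (hc K n hn V hV).trans ?_⟩
  have hθ : 0 ≤ θBal F.L γ b₀ p₀ n := (T3MinimiserStabilityReduction.θBal_pos hL hγ hγ1 hb p₀ n).le
  have hLr : (1 : ℝ) ≤ (F.L : ℝ) := by exact_mod_cast hL
  have hθ2 : θBal F.L γ b₀ p₀ n ^ 2 ≤ (F.L : ℝ) ^ (β * n) :=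
    calc θBal F.L γ b₀ p₀ n ^ 2 ≤ 1 ^ 2 := pow_le_pow_left₀ hθ (hθ1 n) 2
      _ = 1 := one_pow 2
      _ ≤ (F.L : ℝ) ^ (β * n) := Real.one_le_rpow hLr (mul_nonneg hβ (Nat.cast_nonneg n))
  have hra : 0 ≤ (((F.L : ℝ) ^ (K - n))⁻¹) ^ a := Real.rpow_nonneg (inv_nonneg.mpr (pow_nonneg (Nat.cast_nonneg _) _)) a
  have hcard : 0 ≤ C * (Fintype.card (Site (F.P n) 0) : ℝ) := mul_nonneg hC (Nat.cast_nonneg _)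
  exact mul_le_mul_of_nonneg_left (add_le_add (mul_le_mul_of_nonneg_right hθ2 hra) le_rfl) hcard

/-- **THE LANDED ROW IMPLIES THE β-ROW, NO THRESHOLD HYPOTHESIS** (`0 ≤ β`, `L ≥ 1`, `0 < γ ≤ 1`): with the uniform bound `θ(n) ≤ Θ := b₀(2p₀)^{p₀}e^{½−p₀}·γ^{1/4}`
(`T3Thresholds.θBal_le_const_mul_rpow`) the constant becomes `max 1 Θ² · C`. [cite: Balaban1985UV3, (7) p.257; King1986, Thm 3.4 (3.9) p.656] -/
theorem slackB_of_slack_const {b₀ p₀ a β C : ℝ} {σ : ℕ} (hL : 1 ≤ F.L) (hγ : 0 < γ) (hγ1 : γ ≤ 1) (hb : 0 < b₀) (hp : 0 < p₀) (hC : 0 ≤ C)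
    (hβ : 0 ≤ β) (h : GlobalSupRateTSlack D b₀ p₀ a σ C) :
    GlobalSupRateTSlackB D b₀ p₀ a β σ (max 1 ((b₀ * ((2 * p₀) ^ p₀ * Real.exp (1 / 2 - p₀)) * Real.sqrt (Real.sqrt γ)) ^ 2) * C) := by
  obtain ⟨c, hc⟩ := h
  obtain ⟨Θ, hΘdef⟩ : ∃ Θ : ℝ, Θ = b₀ * ((2 * p₀) ^ p₀ * Real.exp (1 / 2 - p₀)) * Real.sqrt (Real.sqrt γ) := ⟨_, rfl⟩
  rw [← hΘdef]
  refine ⟨c, fun K n hn V hV => (hc K n hn V hV).trans ?_⟩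
  have hθ : 0 ≤ θBal F.L γ b₀ p₀ n := (T3MinimiserStabilityReduction.θBal_pos hL hγ hγ1 hb p₀ n).le
  have hθΘ : θBal F.L γ b₀ p₀ n ≤ Θ := by rw [hΘdef]; exact T3Thresholds.θBal_le_const_mul_rpow hL hγ hγ1 hb.le hp n
  have hLr : (1 : ℝ) ≤ (F.L : ℝ) := by exact_mod_cast hL
  have hM1 : 1 ≤ max 1 (Θ ^ 2) := le_max_left _ _
  have hM0 : 0 ≤ max 1 (Θ ^ 2) := zero_le_one.trans hM1
  have hθ2 : θBal F.L γ b₀ p₀ n ^ 2 ≤ max 1 (Θ ^ 2) * (F.L : ℝ) ^ (β * n) :=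
    calc θBal F.L γ b₀ p₀ n ^ 2 ≤ Θ ^ 2 := pow_le_pow_left₀ hθ hθΘ 2
      _ ≤ max 1 (Θ ^ 2) := le_max_right _ _
      _ = max 1 (Θ ^ 2) * 1 := (mul_one _).symm
      _ ≤ max 1 (Θ ^ 2) * (F.L : ℝ) ^ (β * n) :=
          mul_le_mul_of_nonneg_left (Real.one_le_rpow hLr (mul_nonneg hβ (Nat.cast_nonneg n))) hM0
  have hra : 0 ≤ (((F.L : ℝ) ^ (K - n))⁻¹) ^ a := Real.rpow_nonneg (inv_nonneg.mpr (pow_nonneg (Nat.cast_nonneg _) _)) a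
  have hslack : θBal F.L γ b₀ p₀ n ^ σ ≤ max 1 (Θ ^ 2) * θBal F.L γ b₀ p₀ n ^ σ := le_mul_of_one_le_left (pow_nonneg hθ σ) hM1
  have hcard : 0 ≤ C * (Fintype.card (Site (F.P n) 0) : ℝ) := mul_nonneg hC (Nat.cast_nonneg _)
  calc C * (Fintype.card (Site (F.P n) 0) : ℝ) * (θBal F.L γ b₀ p₀ n ^ 2 * (((F.L : ℝ) ^ (K - n))⁻¹) ^ a + θBal F.L γ b₀ p₀ n ^ σ)
      ≤ C * (Fintype.card (Site (F.P n) 0) : ℝ) *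
          (max 1 (Θ ^ 2) * (F.L : ℝ) ^ (β * n) * (((F.L : ℝ) ^ (K - n))⁻¹) ^ a + max 1 (Θ ^ 2) * θBal F.L γ b₀ p₀ n ^ σ) :=
        mul_le_mul_of_nonneg_left (add_le_add (mul_le_mul_of_nonneg_right hθ2 hra) hslack) hcard
    _ = max 1 (Θ ^ 2) * C * (Fintype.card (Site (F.P n) 0) : ℝ) *
          ((F.L : ℝ) ^ (β * n) * (((F.L : ℝ) ^ (K - n))⁻¹) ^ a + θBal F.L γ b₀ p₀ n ^ σ) := by ring

/-- **THE PURE (SERVED) TARGET IMPLIES THE β-ROW** (`0 ≤ β`, constant `max 1 Θ² · C`): `GlobalSlack.slack_of_pure` followed by `slackB_of_slack_const`.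
[cite: King1986, Thm 3.4 (3.9) p.656] -/
theorem slackB_of_pure {b₀ p₀ a β C : ℝ} (hL : 1 ≤ F.L) (hγ : 0 < γ) (hγ1 : γ ≤ 1) (hb : 0 < b₀) (hp : 0 < p₀) (hC : 0 ≤ C) (hβ : 0 ≤ β)
    (σ : ℕ) (h : GlobalSupRateT D b₀ p₀ a C) :
    GlobalSupRateTSlackB D b₀ p₀ a β σ (max 1 ((b₀ * ((2 * p₀) ^ p₀ * Real.exp (1 / 2 - p₀)) * Real.sqrt (Real.sqrt γ)) ^ 2) * C) :=
  slackB_of_slack_const D hL hγ hγ1 hb hp hC hβ (slack_of_pure D hL hγ hγ1 hb hC σ h)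

end Defs

/-! ## §2 The free-fraction arithmetic with the loss: `(3+β)⌊K/m⌋ − a(K − ⌊K/m⌋) ≤ −(a − (3+β+a)/m)·K` -/

/-- **THE FREE-FRACTION EXPONENT WITH A GENERAL SITE WEIGHT `s ≥ 0`**: with `n = ⌊K/m⌋`, `0 < m`, `0 ≤ b`: `s·n − b(K − n) ≤ −(b − (s+b)/m)·K`
(`LogComparisonPolymerBudget.exponent_le` is `s = 3`). [cite: King1986, (3.12)-(3.13) p.657] -/
theorem exponent_le_weight {s b : ℝ} (hs : 0 ≤ s) (hb : 0 ≤ b) {m : ℕ} (hm : 0 < m) (K : ℕ) :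
    (s * (K / m : ℕ) - b * (K - K / m : ℕ) : ℝ) ≤ -(b - (s + b) / m) * K := by
  have hdiv : ((K / m : ℕ) : ℝ) ≤ (K : ℝ) / m := Nat.cast_div_le
  have hle : K / m ≤ K := Nat.div_le_self K m
  have hsub : ((K - K / m : ℕ) : ℝ) = (K : ℝ) - (K / m : ℕ) := by rw [Nat.cast_sub hle]
  rw [hsub]
  have hm' : (0 : ℝ) < m := by exact_mod_cast hm
  have h1 : b * ((K / m : ℕ) : ℝ) ≤ b * ((K : ℝ) / m) := mul_le_mul_of_nonneg_left hdiv hb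
  have h1' : s * ((K / m : ℕ) : ℝ) ≤ s * ((K : ℝ) / m) := mul_le_mul_of_nonneg_left hdiv hs
  have h2 : -(b - (s + b) / m) * (K : ℝ) = s * ((K : ℝ) / m) - b * K + b * ((K : ℝ) / m) := by
    field_simp
    ring
  rw [h2]
  linarith

/-- **GEOMETRIC DECAY WITH THE LOSS**: for `1 < L`, `0 ≤ s`, `0 ≤ b`, `0 < m` and `c = b − (s+b)/m`, `L^{s⌊K/m⌋ − b(K − ⌊K/m⌋)} ≤ (L^{−c})^K`
(`LogComparisonPolymerBudget.rpow_free_fraction_le` is `s = 3`). [cite: King1986, (3.12)-(3.13) p.657] -/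
theorem rpow_free_fraction_le_weight {x : ℝ} (hx : 1 < x) {s b : ℝ} (hs : 0 ≤ s) (hb : 0 ≤ b) {m : ℕ} (hm : 0 < m) (K : ℕ) :
    x ^ ((s * (K / m : ℕ) - b * (K - K / m : ℕ) : ℝ)) ≤ (x ^ (-(b - (s + b) / m))) ^ K := by
  have hx0 : 0 < x := by linarith
  rw [← Real.rpow_natCast, ← Real.rpow_mul hx0.le]
  exact Real.rpow_le_rpow_of_exponent_le hx.le (by have := exponent_le_weight hs hb hm K; linarith)

/-- Threshold arithmetic: `⌈t⌉ + 1 ≤ m ⟹ t < m` (`GlobalSlack.lt_of_ceil_succ_le` is `t = (3+a)/a`). [folklore] -/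
theorem lt_of_ceil_succ_le {t : ℝ} {m : ℕ} (hm : Nat.ceil t + 1 ≤ m) : t < (m : ℝ) := by
  have h1 := Nat.le_ceil t
  have h2 : ((Nat.ceil t + 1 : ℕ) : ℝ) ≤ m := by exact_mod_cast hm
  push_cast at h2
  linarith

/-! ## §3 The direct consumer: the β-row closes S-E″'s output `CauchyAtHeights` once `m > (3+β+a)/a` -/

section Consumer

variable (D : AlphaDataT3 F γ)

/-- **THE DIRECT CONSUMER OF THE β-ROW** (pure counting; the port's `cauchyAtHeights_of_globalSupRateTSlack` with the loss folded into the geometric ratio): for `1 < L`,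
`0 < γ ≤ 1`, `0 < b₀`, `0 < a`, `0 ≤ β`, `0 ≤ C`, `m > (3+β+a)/a`, a geometric profile `θ(n) ≤ C_θρⁿ` (`ρ ≥ 0`) with `ρ^σ·L³ < 1` (any real `p₀`):
`GlobalSupRateTSlackB D b₀ p₀ a β σ C` gives `CauchyAtHeights D b₀ p₀ m`, radii `r′_K = C·|𝕋_{⌊K/m⌋}|·(L^{β⌊K/m⌋}L^{−a(K−⌊K/m⌋)} + θ(⌊K/m⌋)^σ) ≤ A·(L^{−(a−(3+β+a)/m)})^K + B·(q^{1/m})^K`,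
`q = max(ρ^σL³, ½)` — [King1986] (3.12)–(3.13) p.657 «γ′(m−1) > β». [cite: King1986, Thm 3.4 (3.9) p.656 and (3.12)-(3.13) p.657 and (3.42) p.660] -/
theorem cauchyAtHeights_of_globalSupRateTSlackB {b₀ p₀ a β C Cθ ρ : ℝ} {σ m : ℕ}
    (hL : 1 < F.L) (hγ : 0 < γ) (hγ1 : γ ≤ 1) (hb : 0 < b₀) (ha : 0 < a) (hβ : 0 ≤ β) (hC : 0 ≤ C)
    (hm : (3 + β + a) / a < (m : ℝ))
    (hρ : 0 ≤ ρ) (hθρ : ∀ n, θBal F.L γ b₀ p₀ n ≤ Cθ * ρ ^ n) (hρσ : ρ ^ σ * (F.L : ℝ) ^ 3 < 1)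
    (h : GlobalSupRateTSlackB D b₀ p₀ a β σ C) :
    CauchyAtHeights D b₀ p₀ m := by
  classical
  obtain ⟨c, hc⟩ := h
  have hLr : (1 : ℝ) < (F.L : ℝ) := by exact_mod_cast hL
  have hL0 : (0 : ℝ) < (F.L : ℝ) := by linarith
  have h3β : (0 : ℝ) ≤ 3 + β := by linarith
  have hm0r : (0 : ℝ) < m := lt_trans (by positivity) hm
  have hm0 : 0 < m := by exact_mod_cast hm0r
  have hc0 : 0 < a - (3 + β + a) / m := by
    have : (3 + β + a) / (m : ℝ) < a := by
      rw [div_lt_iff₀ hm0r]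
      have := (div_lt_iff₀ ha).mp hm
      linarith
    linarith
  obtain ⟨hr0, hr1⟩ := rpow_neg_lt_one hLr hc0
  have hθ0 : ∀ i, 0 < θBal F.L γ b₀ p₀ i := T3MinimiserStabilityReduction.θBal_pos hL.le hγ hγ1 hb p₀
  have hCθ : 0 ≤ Cθ := by
    have h := (hθ0 0).le.trans (hθρ 0)
    simpa using h
  -- the slack ratio along the free fraction (as in the port)
  obtain ⟨q, hqdef⟩ : ∃ q : ℝ, q = ρ ^ σ * (F.L : ℝ) ^ 3 := ⟨_, rfl⟩
  have hq0 : 0 ≤ q := by rw [hqdef]; positivity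
  obtain ⟨q₁, hq₁def⟩ : ∃ q₁ : ℝ, q₁ = max q (1 / 2) := ⟨_, rfl⟩
  have hq₁0 : 0 < q₁ := by rw [hq₁def]; exact lt_of_lt_of_le (by norm_num) (le_max_right _ _)
  have hq₁1 : q₁ < 1 := by rw [hq₁def, hqdef]; exact max_lt hρσ (by norm_num)
  have hqq₁ : q ≤ q₁ := by rw [hq₁def]; exact le_max_left _ _
  obtain ⟨r₁, hr₁def⟩ : ∃ r₁ : ℝ, r₁ = (F.L : ℝ) ^ (-(a - (3 + β + a) / m)) := ⟨_, rfl⟩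
  obtain ⟨r₂, hr₂def⟩ : ∃ r₂ : ℝ, r₂ = q₁ ^ (1 / (m : ℝ)) := ⟨_, rfl⟩
  have hr₂0 : 0 ≤ r₂ := by rw [hr₂def]; positivity
  have hr₂1 : r₂ < 1 := by rw [hr₂def]; exact Real.rpow_lt_one hq₁0.le hq₁1 (by positivity)
  obtain ⟨A, hAdef⟩ : ∃ A : ℝ, A = C * 8 * (F.L : ℝ) ^ (3 * F.m) := ⟨_, rfl⟩
  obtain ⟨B, hBdef⟩ : ∃ B : ℝ, B = C * 8 * (F.L : ℝ) ^ (3 * F.m) * Cθ ^ σ * q₁⁻¹ := ⟨_, rfl⟩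
  -- the radii
  obtain ⟨r', hr'⟩ : ∃ r' : ℕ → ℝ, ∀ K, r' K = C * (Fintype.card (Site (F.P (K / m)) 0) : ℝ) *
      ((F.L : ℝ) ^ (β * ((K / m : ℕ) : ℝ)) * (((F.L : ℝ) ^ (K - K / m))⁻¹) ^ a + θBal F.L γ b₀ p₀ (K / m) ^ σ) := ⟨_, fun _ => rfl⟩
  have hnn : ∀ K, 0 ≤ r' K := fun K => by
    rw [hr']
    exact mul_nonneg (mul_nonneg hC (Nat.cast_nonneg _))
      (add_nonneg (mul_nonneg (Real.rpow_nonneg hL0.le _) (Real.rpow_nonneg (inv_nonneg.mpr (pow_nonneg hL0.le _)) a))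
        (pow_nonneg (hθ0 _).le σ))
  refine cauchyAtHeights_of_windowBound D r' (fun K => c K (K / m)) ?_ hnn
    (fun K V hV => by rw [hr']; exact hc K (K / m) (Nat.div_le_self K m) V hV)
  -- summability via the majorant `A r₁^K + B r₂^K`
  have hmaj : Summable fun K : ℕ => A * r₁ ^ K + B * r₂ ^ K := by
    rw [hr₁def]
    exact ((summable_geometric_of_lt_one hr0.le hr1).mul_left A).add ((summable_geometric_of_lt_one hr₂0 hr₂1).mul_left B)
  refine hmaj.of_nonneg_of_le hnn fun K => ?_
  rw [hr', card_site_zero]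
  -- the rate term (the loss `L^{β⌊K/m⌋}` joins the site count in the exponent)
  have h1 : C * (8 * (F.L : ℝ) ^ (3 * (F.m + K / m))) * ((F.L : ℝ) ^ (β * ((K / m : ℕ) : ℝ)) * (((F.L : ℝ) ^ (K - K / m))⁻¹) ^ a) ≤
      A * r₁ ^ K := by
    have hpow : (F.L : ℝ) ^ (3 * (F.m + K / m)) * ((F.L : ℝ) ^ (β * ((K / m : ℕ) : ℝ)) * (((F.L : ℝ) ^ (K - K / m))⁻¹) ^ a) =
        (F.L : ℝ) ^ (3 * F.m) * (F.L : ℝ) ^ (((3 + β) * (K / m : ℕ) - a * (K - K / m : ℕ) : ℝ)) := by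
      rw [inv_pow_rpow_eq_rpow hL0, mul_add, pow_add, ← Real.rpow_natCast (F.L : ℝ) (3 * (K / m)), mul_assoc, ← Real.rpow_add hL0,
        ← Real.rpow_add hL0]
      congr 2
      push_cast
      ring
    have hff : (F.L : ℝ) ^ (((3 + β) * (K / m : ℕ) - a * (K - K / m : ℕ) : ℝ)) ≤ r₁ ^ K := by
      rw [hr₁def]; exact rpow_free_fraction_le_weight hLr h3β ha.le hm0 K
    calc C * (8 * (F.L : ℝ) ^ (3 * (F.m + K / m))) * ((F.L : ℝ) ^ (β * ((K / m : ℕ) : ℝ)) * (((F.L : ℝ) ^ (K - K / m))⁻¹) ^ a)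
        = C * 8 * ((F.L : ℝ) ^ (3 * (F.m + K / m)) * ((F.L : ℝ) ^ (β * ((K / m : ℕ) : ℝ)) * (((F.L : ℝ) ^ (K - K / m))⁻¹) ^ a)) := by ring
      _ = C * 8 * ((F.L : ℝ) ^ (3 * F.m) * (F.L : ℝ) ^ (((3 + β) * (K / m : ℕ) - a * (K - K / m : ℕ) : ℝ))) := by rw [hpow]
      _ ≤ C * 8 * ((F.L : ℝ) ^ (3 * F.m) * r₁ ^ K) :=
          mul_le_mul_of_nonneg_left (mul_le_mul_of_nonneg_left hff (by positivity)) (by positivity)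
      _ = A * r₁ ^ K := by rw [hAdef]; ring
  -- the slack term (as in the port)
  have h2 : C * (8 * (F.L : ℝ) ^ (3 * (F.m + K / m))) * θBal F.L γ b₀ p₀ (K / m) ^ σ ≤ B * r₂ ^ K := by
    have hθσ : θBal F.L γ b₀ p₀ (K / m) ^ σ ≤ Cθ ^ σ * (ρ ^ σ) ^ (K / m) := by
      calc θBal F.L γ b₀ p₀ (K / m) ^ σ ≤ (Cθ * ρ ^ (K / m)) ^ σ := pow_le_pow_left₀ (hθ0 _).le (hθρ _) σ
        _ = Cθ ^ σ * (ρ ^ σ) ^ (K / m) := by rw [mul_pow, ← pow_mul, ← pow_mul, mul_comm (K / m) σ]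
    have hL3 : (F.L : ℝ) ^ (3 * (F.m + K / m)) = (F.L : ℝ) ^ (3 * F.m) * ((F.L : ℝ) ^ 3) ^ (K / m) := by
      rw [← pow_mul, ← pow_add, ← mul_add]
    have hqK : (ρ ^ σ) ^ (K / m) * ((F.L : ℝ) ^ 3) ^ (K / m) = q ^ (K / m) := by rw [hqdef, mul_pow]
    have hq₁K : q ^ (K / m) ≤ q₁ ^ (K / m) := pow_le_pow_left₀ hq0 hqq₁ _
    have hgeom : q₁ ^ (K / m) ≤ q₁⁻¹ * r₂ ^ K := by rw [hr₂def]; exact pow_div_le_geom hq₁0 hq₁1.le hm0 K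
    calc C * (8 * (F.L : ℝ) ^ (3 * (F.m + K / m))) * θBal F.L γ b₀ p₀ (K / m) ^ σ
        ≤ C * (8 * (F.L : ℝ) ^ (3 * (F.m + K / m))) * (Cθ ^ σ * (ρ ^ σ) ^ (K / m)) :=
          mul_le_mul_of_nonneg_left hθσ (by positivity)
      _ = C * 8 * (F.L : ℝ) ^ (3 * F.m) * Cθ ^ σ * ((ρ ^ σ) ^ (K / m) * ((F.L : ℝ) ^ 3) ^ (K / m)) := by rw [hL3]; ring
      _ = C * 8 * (F.L : ℝ) ^ (3 * F.m) * Cθ ^ σ * q ^ (K / m) := by rw [hqK]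
      _ ≤ C * 8 * (F.L : ℝ) ^ (3 * F.m) * Cθ ^ σ * (q₁⁻¹ * r₂ ^ K) :=
          mul_le_mul_of_nonneg_left (hq₁K.trans hgeom) (by positivity)
      _ = B * r₂ ^ K := by rw [hBdef]; ring
  calc C * (8 * (F.L : ℝ) ^ (3 * (F.m + K / m))) *
        ((F.L : ℝ) ^ (β * ((K / m : ℕ) : ℝ)) * (((F.L : ℝ) ^ (K - K / m))⁻¹) ^ a + θBal F.L γ b₀ p₀ (K / m) ^ σ)
      = C * (8 * (F.L : ℝ) ^ (3 * (F.m + K / m))) * ((F.L : ℝ) ^ (β * ((K / m : ℕ) : ℝ)) * (((F.L : ℝ) ^ (K - K / m))⁻¹) ^ a) +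
          C * (8 * (F.L : ℝ) ^ (3 * (F.m + K / m))) * θBal F.L γ b₀ p₀ (K / m) ^ σ := by ring
    _ ≤ A * r₁ ^ K + B * r₂ ^ K := add_le_add h1 h2

/-- **THE DIRECT CONSUMER OF THE β-ROW, SHARP PROFILE, `σ ≥ 7`** (print's «overall power greater than six»): for `1 < L`, `0 < γ ≤ 1`, `0 < b₀`, `0 < p₀`, `0 < a`,
`0 ≤ β`, `0 ≤ C`, `m > (3+β+a)/a` and `7 ≤ σ`, `GlobalSupRateTSlackB D b₀ p₀ a β σ C` gives `CauchyAtHeights D b₀ p₀ m` (`c = 1/8`: `ρ = L^{−7/16}`, `ρ⁷L³ = L^{−1/16} < 1`).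
[cite: Balaban1985UV3, (57) p.270; King1986, Thm 3.4 (3.9) p.656 and (3.42) p.660] -/
theorem cauchyAtHeights_of_globalSupRateTSlackB_seven {b₀ p₀ a β C : ℝ} {σ m : ℕ}
    (hL : 1 < F.L) (hγ : 0 < γ) (hγ1 : γ ≤ 1) (hb : 0 < b₀) (hp : 0 < p₀) (ha : 0 < a) (hβ : 0 ≤ β) (hC : 0 ≤ C)
    (hm : (3 + β + a) / a < (m : ℝ)) (hσ : 7 ≤ σ) (h : GlobalSupRateTSlackB D b₀ p₀ a β σ C) :
    CauchyAtHeights D b₀ p₀ m := by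
  have hc : (0 : ℝ) < 1 / 8 := by norm_num
  have hσr : (7 : ℝ) ≤ σ := by exact_mod_cast hσ
  refine cauchyAtHeights_of_globalSupRateTSlackB D hL hγ hγ1 hb ha hβ hC hm (ρ := ((F.L : ℝ)⁻¹) ^ ((1 - 1 / 8 : ℝ) / 2))
    (Cθ := b₀ * ((p₀ / (1 / 8)) ^ p₀ * Real.exp (1 / 8 - p₀)) * γ ^ ((1 - 1 / 8 : ℝ) / 2))
    (by positivity) (fun n => θBal_le_geometric_sharp hL.le hγ hγ1 hb.le hp hc n) ?_ h
  exact slack_ratio_lt_one hL (by nlinarith)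

/-- **THE DIRECT CONSUMER OF THE LANDED ROW THROUGH THE β-ROW** (sanity composition, `β = 0`, constant `max 1 Θ²·C`): the port's `σ ≥ 7` consumer is recovered from
this file's (same threshold `m > (3+a)/a`). [cite: King1986, Thm 3.4 (3.9) p.656] -/
theorem cauchyAtHeights_of_globalSupRateTSlack_via_beta {b₀ p₀ a C : ℝ} {σ m : ℕ}
    (hL : 1 < F.L) (hγ : 0 < γ) (hγ1 : γ ≤ 1) (hb : 0 < b₀) (hp : 0 < p₀) (ha : 0 < a) (hC : 0 ≤ C)
    (hm : (3 + a) / a < (m : ℝ)) (hσ : 7 ≤ σ) (h : GlobalSupRateTSlack D b₀ p₀ a σ C) :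
    CauchyAtHeights D b₀ p₀ m := by
  have hB := slackB_of_slack_const D hL.le hγ hγ1 hb hp hC le_rfl h
  refine cauchyAtHeights_of_globalSupRateTSlackB_seven D hL hγ hγ1 hb hp ha le_rfl (mul_nonneg ?_ hC) (by simpa using hm) hσ hB
  exact zero_le_one.trans (le_max_left _ _)

end Consumer

/-! ## §4 The registered-shape S-E″ slot over the β-row (`β` bound next to `a`, before `m₀`; drop-in for `landed_levelCauchyOfGlobalSupRateTSlack` of v5j‴ at the v5j⁗ re-cut) -/

/-- **THE S-E″ SLOT OVER THE β-ROW, REGISTERED QUANTIFIER SHAPE** (`ε₁ = γ₁ = 1`, `m₀ = ⌈(3+β+a)/a⌉ + 1`; `σ ≥ 7` and `C ≥ 0` may depend on the family; `β ≥ 0` is bound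
next to `a`, BEFORE `m₀` — the free fraction must beat the loss, [King1986] (3.13) «γ′(m−1) > β»): `GlobalSupRateTSlackB D b₀ p₀ a β σ C → CauchyAtHeights D b₀ p₀ m`.
[cite: King1986, Thm 3.4 (3.9) p.656 and (3.12)-(3.13) p.657] -/
theorem levelCauchyOfGlobalSupRateTSlackB_dec :
    ∀ (L : ℕ), Odd L → 1 < L → ∀ (a : ℝ), 0 < a → ∀ (β : ℝ), 0 ≤ β →
      ∃ ε₁ : ℝ, 0 < ε₁ ∧ ∀ (ε₀ : ℝ), 0 < ε₀ → ε₀ ≤ ε₁ → ∃ m₀ : ℕ, ∀ (m : ℕ), m₀ ≤ m → ∀ (b₀ p₀ : ℝ), 0 < b₀ → 2 < p₀ →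
        ∃ γ₁ : ℝ, 0 < γ₁ ∧ ∀ (F : T3Family) (γ : ℝ), F.L = L → 0 < γ → γ ≤ γ₁ →
          ∀ (D : AlphaDataT3 F γ) (σ : ℕ) (C : ℝ), 7 ≤ σ → 0 ≤ C → GlobalSupRateTSlackB D b₀ p₀ a β σ C → CauchyAtHeights D b₀ p₀ m := by
  intro L _ hL a ha β hβ
  refine ⟨1, one_pos, fun ε₀ _ _ => ⟨Nat.ceil ((3 + β + a) / a) + 1, fun m hm b₀ p₀ hb hp => ?_⟩⟩
  refine ⟨1, one_pos, fun F γ hF hγ hγ1 D σ C hσ hC h => ?_⟩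
  have hL' : 1 < F.L := by rw [hF]; exact hL
  exact cauchyAtHeights_of_globalSupRateTSlackB_seven D hL' hγ hγ1 hb (by linarith) ha hβ hC (lt_of_ceil_succ_le hm) hσ h

/-- **THE SAME SLOT WITH `m₀` MONOTONE-FREE IN `β ≤ β₁`** (one `m₀ = ⌈(3+β₁+a)/a⌉ + 1` serves every `0 ≤ β ≤ β₁` — e.g. print's `β₁ = d + ½ = 7/2`): usable if the
re-cut binds `β` per family under a uniform cap `β ≤ β₁` fixed next to `a`. [cite: King1986, (3.42) p.660 and (3.12)-(3.13) p.657] -/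
theorem levelCauchyOfGlobalSupRateTSlackB_dec_capped :
    ∀ (L : ℕ), Odd L → 1 < L → ∀ (a : ℝ), 0 < a → ∀ (β₁ : ℝ), 0 ≤ β₁ →
      ∃ ε₁ : ℝ, 0 < ε₁ ∧ ∀ (ε₀ : ℝ), 0 < ε₀ → ε₀ ≤ ε₁ → ∃ m₀ : ℕ, ∀ (m : ℕ), m₀ ≤ m → ∀ (b₀ p₀ : ℝ), 0 < b₀ → 2 < p₀ →
        ∃ γ₁ : ℝ, 0 < γ₁ ∧ ∀ (F : T3Family) (γ : ℝ), F.L = L → 0 < γ → γ ≤ γ₁ →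
          ∀ (D : AlphaDataT3 F γ) (β : ℝ) (σ : ℕ) (C : ℝ), 0 ≤ β → β ≤ β₁ → 7 ≤ σ → 0 ≤ C →
            GlobalSupRateTSlackB D b₀ p₀ a β σ C → CauchyAtHeights D b₀ p₀ m := by
  intro L _ hL a ha β₁ _
  refine ⟨1, one_pos, fun ε₀ _ _ => ⟨Nat.ceil ((3 + β₁ + a) / a) + 1, fun m hm b₀ p₀ hb hp => ?_⟩⟩
  refine ⟨1, one_pos, fun F γ hF hγ hγ1 D β σ C hβ hβ1 hσ hC h => ?_⟩
  have hL' : 1 < F.L := by rw [hF]; exact hL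
  have hm1 : (3 + β₁ + a) / a < (m : ℝ) := lt_of_ceil_succ_le hm
  have hmβ : (3 + β + a) / a < (m : ℝ) := lt_of_le_of_lt (div_le_div_of_nonneg_right (by linarith) ha.le) hm1
  exact cauchyAtHeights_of_globalSupRateTSlackB_seven D hL' hγ hγ1 hb (by linarith) ha hβ hC hmβ hσ h

end Summit.QuantumFields.YangMills.Theorems.GlobalSlackBeta

end
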